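import Summits.QuantumFields.YangMills.Theorems.AlphaInputsT3ACv3LocalSmallRead
import Summits.QuantumFields.YangMills.Theorems.AlphaInputsT3ACv3AdaptedClassL
import HarnessLib

/-!
# `AlphaInputsT3ACv3LocalSmallT3Read` — STRATEGY B for 2′: THE (D6L)-CORE INTERFACE AT THE T³ OBJECTS — `U ∈ localSmallT3 k h` from FINE-plaquette smallness on ONE fine box
# of radius `13·L^{i₀}` around `toFine i₀ c₀₋` per READ bond `c₀ ∈ readBondsT3 k h i₀` — lane `pub-balaban3d`, seat alpha-2 (g2)

WHAT.  `LocalSmallLoop.nestedSmallOn_hull_of_plaqSmallOn_readBoxes` (sibling `…LocalSmallRead`) read at `P = F.P K`, `ℰ = ℰp` (`δ_SU(2) = ⅓`, margin `δ/2 = ⅙`), `d = 3`,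
`E = coneT3 k h = hull (readBondsT3 k h)`: ★ `AlphaInputsT3AC.localSmallT3_of_plaqSmallOn_readBoxes`.  The chains of block centres are eliminated from the interface: the bottom of
the chain below a level-`i₀` site `y` IS `toFine i₀ y` (`toFine_chain_zero`), so the hypothesis is ONE `PlaqSmallOn (boxRegion (toFine i₀ c₀.src) (13·L^{i₀})) (α₀·(L^{i₀})⁻²) U`
per read bond — with `toFine i₀ c₀.src ∈ lam42 Ω(h) k i` for some `i ≥ i₀` by the definition of the read bonds.  What is left for a (D6L)-core witness is Ω-geometry + its
fine-plaquette bounds within `13·L^{i₀} + 1` of `Λ_i(h)`, `i ≥ i₀`, at scale `L^{−2i₀}` (HOME `D6-AUDIT-alpha2-g2.md` §4).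
HONEST FRAMING.  Plumbing; no estimate; count-neutral helper toward R3 2′ (`stub_laneRecordsV3`, items 19935∕19936); nothing about d = 4, the continuum, or a mass gap.

References: T. Bałaban, Commun. Math. Phys. 98 (1985) 17–51 [Balaban1985Averaging] (Props. 1–2 p.26); CMP 102 (1985) 255–275 [Balaban1985UV3] ((42) p.266, (68) p.273).
-/

set_option autoImplicit false

noncomputable section

namespace Summit.QuantumFields.YangMills.Theorems

open Set
open Literature.MathematicalPhysics.QuantumFieldTheory.Balaban1983to89
open Literature.MathematicalPhysics.QuantumFieldTheory.Balaban1983to89.ExpMeanLog (expMeanLogSU deltaSU)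
open Literature.MathematicalPhysics.QuantumFieldTheory.Balaban1983to89.T3ContinuumYM3Torus
open Literature.MathematicalPhysics.QuantumFieldTheory.Balaban1983to89.T3UnitLawDensityEML (ℰp)
open Literature.MathematicalPhysics.QuantumFieldTheory.Balaban1983to89.B10Eq38TorusDomains (toFine toFine_zero toFine_succ)
open Literature.MathematicalPhysics.QuantumFieldTheory.Balaban1983to89.B10Eq42TorusConstraint (bondsIn lam42)
open Literature.MathematicalPhysics.QuantumFieldTheory.Balaban1985CMP102.Setting
open Summit.QuantumFields.Balaban3D.Carriers
open Summit.QuantumFields.Balaban3D.Proofs.Primitives (AlphaConsts)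
open Summit.QuantumFields.YangMills.BalabanUVNodes.N20LCSAvgDominationRegion (boxRegion)
open Summit.QuantumFields.YangMills.Theorems.LocalSmallLoop (hull nestedSmallOn_hull_of_plaqSmallOn_readBoxes)

/-! ## §1 The bottom of a chain of block centres is `toFine` -/

/-- Along a chain of block centres (`xs l = emb (xs (l+1))`, `l < i`) the bottom site is the fine representative of the top: `xs 0 = toFine i (xs i)`. [folklore] -/
theorem toFine_chain_zero {P : Params} : ∀ (i : ℕ) (xs : (l : ℕ) → Site P l), (∀ l, l < i → xs l = emb (xs (l + 1))) → xs 0 = toFine i (xs i)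
  | 0, _, _ => rfl
  | i + 1, xs, h => by
    rw [toFine_succ, ← h i (Nat.lt_succ_self i)]
    exact toFine_chain_zero i xs fun l hl => h l (Nat.lt_succ_of_lt hl)

/-! ## §2 The interface at the T³ objects -/

section T3

variable {F : T3Family} {𝔠 : AlphaConsts F.L (suGroupModel 2).N} {γ : ℝ} {hγ : 0 < γ} {hγ1 : γ ≤ (min 𝔠.gamma0 1) ^ 2} {K : ℕ}

/-- Above the top level there are no read bonds. [folklore] -/
theorem AlphaInputsT3AC.readBondsT3_eq_empty_of_lt {k : ℕ} (h : Hist (F.P K) k) {i : ℕ} (hki : k < i) :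
    AlphaInputsT3AC.readBondsT3 F 𝔠 γ hγ hγ1 K k h i = ∅ := by
  ext b
  simp only [AlphaInputsT3AC.readBondsT3, mem_setOf_eq, mem_empty_iff_false, iff_false, not_exists, not_and]
  intro i' hi' hik _
  omega

/-- **★ THE (D6L)-CORE INTERFACE AT THE T³ OBJECTS.**  `U ∈ localSmallT3 k h` (`k ≤ K`) as soon as for every level `i₀ ≤ k` and every READ bond `c₀ ∈ readBondsT3 k h i₀` the FINE
plaquettes of `U` are `α₀·(L^{i₀})⁻²`-small on the fine box `boxRegion (toFine i₀ c₀.src) (13·L^{i₀})`, with `0 < α₀`, `C₀(3)α₀ ≤ ⅓` (`C₀(3) = 143·(49/4)²`),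
`2α₀ ≤ 2δ_SU(2)/(7L)²` and `((5L)²/4)(α₀ + 2C₀(3)α₀²) ≤ δ_SU(2)/2` (all met by `α₀ = ½C68·g p(g)` on the record's window, `C68·g p(g) ≤ σ₆₈ ≤ c₂′(3,L)/2`).
[cite: Balaban1985Averaging, Prop. 2 (52)–(54) p.26 + Prop. 1 (51) p.26; Balaban1985UV3, (42) p.266 + (68) p.273] -/
theorem AlphaInputsT3AC.localSmallT3_of_plaqSmallOn_readBoxes {k : ℕ} (hk : k ≤ K) (h : Hist (F.P K) k) {α₀ : ℝ} (hα : 0 < α₀)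
    (hα3 : (143 * ((((3 + 4 : ℕ) : ℝ)) ^ 2 / 4) ^ 2) * α₀ ≤ 1 / 3)
    (hα2 : 2 * α₀ ≤ 2 * deltaSU (Fin 2) / (((3 + 4) * F.L : ℕ) : ℝ) ^ 2)
    (hδ : ((((3 + 2) * F.L : ℕ) : ℝ) ^ 2 / 4) * (α₀ + 2 * (143 * ((((3 + 4 : ℕ) : ℝ)) ^ 2 / 4) ^ 2) * α₀ ^ 2) ≤ deltaSU (Fin 2) / 2)
    {U : GaugeField (F.P K) 0 (Matrix.specialUnitaryGroup (Fin 2) ℂ)}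
    (hU : ∀ i₀, i₀ ≤ k → ∀ c₀ ∈ AlphaInputsT3AC.readBondsT3 F 𝔠 γ hγ hγ1 K k h i₀,
      PlaqSmallOn (↑(boxRegion (toFine i₀ c₀.src) (13 * F.L ^ i₀)) : Set (Plaq (F.P K) 0)) (α₀ * (((F.L : ℝ) ^ i₀)⁻¹) ^ 2) U) :
    U ∈ AlphaInputsT3AC.localSmallT3 F 𝔠 γ hγ hγ1 K k h := by
  have hkm : k ≤ (F.P K).m + (F.P K).K := AlphaInputsT3AC.le_standing_of_le hk
  -- `L` odd and `> 1`, so `L ≥ 3` (the tree's `CritCurvGradLog.three_le_L`, inlined)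
  have hL3 : 3 ≤ (F.P K).L := by obtain ⟨⟨r, hr⟩, h1⟩ := F.hL; show 3 ≤ F.L; omega
  refine nestedSmallOn_hull_of_plaqSmallOn_readBoxes (P := F.P K) (n := Fin 2) (R := AlphaInputsT3AC.readBondsT3 F 𝔠 γ hγ hγ1 K k h)
    (fun i hi => AlphaInputsT3AC.readBondsT3_eq_empty_of_lt h (lt_of_le_of_lt hkm hi)) hkm hL3 hα hα3 hα2 hδ
    fun i₀ _ c₀ hc₀ xs hxi hxch => ?_
  obtain ⟨i, hi₀, hik, hb⟩ := hc₀
  have h0 : xs 0 = toFine i₀ c₀.src := by rw [← hxi]; exact toFine_chain_zero i₀ xs hxch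
  rw [h0]
  exact hU i₀ (hi₀.trans hik) c₀ ⟨i, hi₀, hik, hb⟩

end T3

end Summit.QuantumFields.YangMills.Theorems

end
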